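/-
Origin: expansion seat `planner-pub-hodgecm-pv13-g6-0`, handover #4 2026-08-18T15:24Z (md5 34e9d85d9422539ae802a2d44088c2c6, 289 l., 17 decls; NEW additive leaf; imports TREE `HodgeCM.PerL34.GenuineSchrodingerCoeff` (installed, pv07-g4) + ONE import rewrite `import Pv13g6.GenuineSchrodingerHeisTranslate` ↦ `import HodgeCM.PerL34.GenuineSchrodingerHeisTranslate` (row #1a d77087c8); land AFTER row #1a (independent of 1b/1c/2/3); HOLD iff row #1a held) (`HOME/pub-hodgecm-pv13-g6/lean/Pv13g6/GenuineSchrodingerLeviSmooth.lean`, md5 34e9d85d, 289 lines);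
landed by the gen-8 packager in gate run 31 as `HodgeCM/PerL34/GenuineSchrodingerLeviSmooth.lean` (import ^import Pv13g6\.GenuineSchrodingerHeisTranslate[ \t]*$→import HodgeCM.PerL34.GenuineSchrodingerHeisTranslate ×1).
-/
/-
Copyright (c) 2026. All rights reserved.
Released under Apache 2.0 license as described in the file LICENSE.
Authors: unit pub-hodgecm-pv13-g6 (DAG-NODE PROVER #13 gen 6, seam S3, 𝓕-side).

# HodgeCM/PerL34/GenuineSchrodingerLeviSmooth.lean — every Schwartz–Bruhat vector of `L²(X)` is fixed
# by a level subgroup `K_T` of the norm-one torus acting through the genuine split Weil representation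
-/
import Summits.HodgeConjecture.HodgeCM.PerL34.GenuineSchrodingerCoeff_3
import Summits.HodgeConjecture.HodgeCM.PerL34.GenuineSchrodingerHeisTranslate

/-!
# `𝒮(X) ⊆ L²(X)^{K_T}`: Schwartz–Bruhat test vectors are level-`T` spherical for the torus action

`X = Space L`, `L²(X) = Lp ℂ 2 (μ L)`, `ω_ν = rep L ν` the genuine global split Weil (dilation)
representation of the model group `Model L = Πʳ_v [T¹(L⁺_v), T¹(𝒪_v)]` (pv13-g4 `GenuineSchrodingerModel`),
`K_T = RestrictedProduct.boxSubgroup (genLevel L) T` its compact open level subgroups (all local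
coordinates integral, and trivial at the places of the finite set `T`), `𝒮(X) = schwartzBruhat L`.

pv07-g4 (`GenuineSchrodingerCoeff`, theorem `rep_phi0_eq_self_of_mem_boxSubgroup`) proved the `hK`
binder of the END theorem for the spherical vector `φ⁰ = 1_{∏ 𝒪_v³}` only.  The print (PerL-v5-FULL
ll. 617–622, "test vectors `φ = ⊗ φ_v`, `φ_v = 1_{D_v}` … `K`-finite") needs it for ARBITRARY
Schwartz–Bruhat test vectors.  PROVED HERE, in the kernel, from the installed tree only:

* §1 `smul_mem_ballCoset_iff_of_norm` — an element `k` with norm-one split coordinates `u_j` and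
  `‖(u_j - 1) x₀_j‖ ≤ r_n(j)` for all `j` maps the level coset `x₀ + B_n` onto itself (ultrametric
  estimate `k•x - x₀ = u•(x - x₀) + (u - 1)•x₀`); `exists_finset_norm_sub_one_smul_le` — for every
  centre `x₀` and level `n` some `K_T` satisfies that smallness condition (take `T` = the finitely many
  places where `r_n < 1` or `x₀` is non-integral).
* §2 `rep_one_indicatorConstLp_of_invariant` — `ω_1(k) 1_A = 1_A` whenever `k` has norm-one split
  coordinates and `k • A = A` (`ω_1(k)` is then the measure-preserving pull-back, weight `1`).
* §3 `exists_finset_forall_smul_mem_iff` — a compact open `A ⊆ X` is `K_T`-invariant for some finite `T`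
  (finitely many level cosets of one level, row 1a `exists_level_saturate`); HEADLINE
  `exists_finset_forall_rep_one_eq_self` — every `f ∈ 𝒮(X)` is fixed by `ω_1(K_T)` for some finite `T`; `exists_finset_forall_rep_eq_smul` — hence `ω_ν(k) f = ν(k) f` on `K_T` for every
  character `ν` (the `hK` binder of `Coeff.exists_coeff_closedForm_genuine` for all of `𝒮(X)`, once `ν`
  is trivial on `K_T`, which pv07-g4 `exists_level_char_trivial` supplies).

## ABSOLUTE RULE

Nothing is cited and nothing is posited: no axiom, no placeholder, no PerL / QW8 / 2001-programme
claim; every statement is proved from Mathlib and the installed package (imports above; the second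
import is this seat's RUN-31 row 1a, installed as `HodgeCM.PerL34.GenuineSchrodingerHeisTranslate`).
The local measurable-structure binders `[∀ v, MeasurableSpace (L⁺_v)]` of pv07-g4's main section are
NOT needed here and are avoided (the three small lemmas of that section we use are re-derived).

Namespace `HodgeCM.PerL34.PureTensor.SchrodingerModel.Coeff`.
-/

set_option autoImplicit false

noncomputable section

open MeasureTheory MeasureTheory.Measure Set Metric Function Complex Topology Filter
open scoped RestrictedProduct InnerProductSpace NNReal ENNReal Pointwise

namespace HodgeCM.PerL34.PureTensor.SchrodingerModel

open HodgeCM.PerL34.LocalFactors HodgeCM.PerL34.LocalFactors.DilationModel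
open HodgeCM.PerL34.LocalFactors.SchrodingerLevi HodgeCM.PerL34.LocalFactors.SchrodingerIrreducible
open HodgeCM.PerL34.IdelePlaces HodgeCM.PerL34.IdelicTorusModel HodgeCM.PerL34.IdelicTorusModel.Genuine
open HodgeCM.PerL34.NoSmallSubgroups NumberField IsDedekindDomain

attribute [local instance] LocalFactors.DilationModel.Adic.nontriviallyNormedField
  LocalFactors.DilationModel.Adic.properSpace

variable {L : Type} [Field L] [NumberField L] [IsCMField L]

/-- the split local field at a split index -/
local notation3 "𝕂" i => (basePlaceOf L (Subtype.val i)).adicCompletion (maximalRealSubfield L)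

namespace Coeff

/-! ## §1  Level subgroups of the model group preserve level cosets of `X` -/

/-- the split coordinates of an element of `K_T` are norm-one units -/
theorem norm_unitAt_eq_one_of_mem_boxSubgroup {T : Finset (Place (maximalRealSubfield L))} {k : Model L}
    (hk : k ∈ RestrictedProduct.boxSubgroup (genLevel L) T) (j : SplitIdx L) :
    ‖((unitAt k j : (𝕂 j)ˣ) : 𝕂 j)‖ = 1 :=
  (mem_genLevel_iff_norm_baseTriv_eq_one L j.1 j.2 (k j.1)).1
    (((RestrictedProduct.mem_boxSubgroup_iff T k).1 hk).1 j.1)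

/-- at the places of `T` the split coordinates of an element of `K_T` are `1` -/
theorem unitAt_eq_one_of_mem_boxSubgroup {T : Finset (Place (maximalRealSubfield L))} {k : Model L}
    (hk : k ∈ RestrictedProduct.boxSubgroup (genLevel L) T) {j : SplitIdx L} (hj : j.1 ∈ T) :
    unitAt k j = 1 := by
  have h : k j.1 = 1 := ((RestrictedProduct.mem_boxSubgroup_iff T k).1 hk).2 j.1 hj
  simp only [unitAt, h, map_one]

/-- for a norm-one unit `u`, `‖(u⁻¹ - 1) y‖ = ‖(u - 1) y‖` -/
theorem norm_inv_sub_one_smul (j : SplitIdx L) {u : (𝕂 j)ˣ} (hu : ‖(u : 𝕂 j)‖ = 1) (y : Coord L j) :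
    ‖(((u⁻¹ : (𝕂 j)ˣ) : 𝕂 j) - 1) • y‖ = ‖((u : 𝕂 j) - 1) • y‖ := by
  rw [norm_smul, norm_smul, Units.val_inv_eq_inv_val]
  congr 1
  have h0 : (u : 𝕂 j) ≠ 0 := u.ne_zero
  have e : (u : 𝕂 j)⁻¹ - 1 = (u : 𝕂 j)⁻¹ * (1 - u) := by
    rw [mul_sub, mul_one, inv_mul_cancel₀ h0]
  rw [e, norm_mul, norm_inv, hu, inv_one, one_mul, norm_sub_rev]

/-- the ultrametric coset estimate: `k • x - x₀ = u • (x - x₀) + (u - 1) • x₀` coordinatewise, so an element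
with norm-one split coordinates `u_j` and `‖(u_j - 1) x₀_j‖ ≤ r_n(j)` maps `x₀ + B_n` into itself -/
theorem smul_mem_ballCoset_of_norm (k : Model L) (hk : ∀ j : SplitIdx L, ‖((unitAt k j : (𝕂 j)ˣ) : 𝕂 j)‖ = 1)
    {x₀ : Space L} {n : ℕ} (hkx : ∀ j : SplitIdx L, ‖(((unitAt k j : (𝕂 j)ˣ) : 𝕂 j) - 1) • x₀ j‖ ≤ rad L n j)
    {x : Space L} (hx : x ∈ ballCoset L x₀ n) : k • x ∈ ballCoset L x₀ n := by
  rw [mem_ballCoset_iff_sub_mem, mem_levelBall_iff] at hx ⊢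
  intro j
  have e : (k • x - x₀) j
      = ((unitAt k j : (𝕂 j)ˣ) : 𝕂 j) • (x - x₀) j + (((unitAt k j : (𝕂 j)ˣ) : 𝕂 j) - 1) • x₀ j := by
    rw [RestrictedProduct.sub_apply, RestrictedProduct.sub_apply, SchrodingerModel.smul_apply, smul_sub,
      sub_smul, one_smul]
    abel
  rw [e]
  refine (IsUltrametricDist.norm_add_le_max _ _).trans (max_le ?_ (hkx j))
  rw [norm_smul, hk j, one_mul]
  exact hx j

/-- … and onto itself -/
theorem smul_mem_ballCoset_iff_of_norm (k : Model L) (hk : ∀ j : SplitIdx L, ‖((unitAt k j : (𝕂 j)ˣ) : 𝕂 j)‖ = 1)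
    {x₀ : Space L} {n : ℕ} (hkx : ∀ j : SplitIdx L, ‖(((unitAt k j : (𝕂 j)ˣ) : 𝕂 j) - 1) • x₀ j‖ ≤ rad L n j)
    (x : Space L) : k • x ∈ ballCoset L x₀ n ↔ x ∈ ballCoset L x₀ n := by
  refine ⟨fun h => ?_, smul_mem_ballCoset_of_norm k hk hkx⟩
  have h' := smul_mem_ballCoset_of_norm k⁻¹ (fun j => norm_unitAt_inv k j (hk j)) (x₀ := x₀) (n := n)
    (fun j => by rw [unitAt_inv, norm_inv_sub_one_smul j (hk j)]; exact hkx j) h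
  rwa [inv_smul_smul] at h'

/-- for every centre `x₀` and level `n` there is a finite set `T` of places such that every `k ∈ K_T` satisfies
the smallness condition of `smul_mem_ballCoset_of_norm`: `T` = the places of the finitely many split indices
where `r_n < 1` or where `x₀` is not integral -/
theorem exists_finset_norm_sub_one_smul_le (x₀ : Space L) (n : ℕ) :
    ∃ T : Finset (Place (maximalRealSubfield L)), ∀ k ∈ RestrictedProduct.boxSubgroup (genLevel L) T,
      ∀ j : SplitIdx L, ‖(((unitAt k j : (𝕂 j)ˣ) : 𝕂 j) - 1) • x₀ j‖ ≤ rad L n j := by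
  classical
  have hfin₁ : {j : SplitIdx L | enumIdx L j < n}.Finite := finite_enumIdx_lt L n
  have hfin₂ : {j : SplitIdx L | x₀ j ∉ (cube L j : Set (Coord L j))}.Finite := by
    have h := x₀.2
    rwa [Filter.eventually_cofinite] at h
  refine ⟨(hfin₁.union hfin₂).toFinset.image (fun j : SplitIdx L => j.1), fun k hk j => ?_⟩
  by_cases hj : j ∈ (hfin₁.union hfin₂).toFinset
  · rw [unitAt_eq_one_of_mem_boxSubgroup hk (Finset.mem_image_of_mem _ hj), Units.val_one, sub_self,
      zero_smul, norm_zero]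
    exact (rad_pos L n j).le
  · rw [Set.Finite.mem_toFinset, Set.mem_union, Set.mem_setOf_eq, Set.mem_setOf_eq, not_or, not_not] at hj
    rw [rad_of_not_lt hj.1, norm_smul]
    have h1 : ‖((unitAt k j : (𝕂 j)ˣ) : 𝕂 j) - 1‖ ≤ 1 := by
      rw [sub_eq_add_neg]
      refine (IsUltrametricDist.norm_add_le_max _ _).trans (max_le ?_ ?_)
      · exact (norm_unitAt_eq_one_of_mem_boxSubgroup hk j).le
      · rw [norm_neg, norm_one]
    have h2 : ‖x₀ j‖ ≤ 1 := (mem_cube_iff L j _).1 hj.2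
    calc ‖((unitAt k j : (𝕂 j)ˣ) : 𝕂 j) - 1‖ * ‖x₀ j‖ ≤ 1 * 1 :=
        mul_le_mul h1 h2 (norm_nonneg _) zero_le_one
      _ = 1 := one_mul 1

/-- hence: every level coset `x₀ + B_n` is invariant under some `K_T` -/
theorem exists_finset_smul_mem_ballCoset_iff (x₀ : Space L) (n : ℕ) :
    ∃ T : Finset (Place (maximalRealSubfield L)), ∀ k ∈ RestrictedProduct.boxSubgroup (genLevel L) T,
      ∀ x : Space L, k • x ∈ ballCoset L x₀ n ↔ x ∈ ballCoset L x₀ n := by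
  obtain ⟨T, hT⟩ := exists_finset_norm_sub_one_smul_le x₀ n
  exact ⟨T, fun k hk x =>
    smul_mem_ballCoset_iff_of_norm k (norm_unitAt_eq_one_of_mem_boxSubgroup hk) (hT k hk) x⟩

/-! ## §2  `ω_1(k)` fixes the indicators of `k`-invariant sets -/

/-- the modulus of an element with norm-one split coordinates is `1` (pv07-g4, restated without the unused local
measurable-structure binders) -/
theorem distribHaarChar_eq_one_of_norm' (k : Model L) (hk : ∀ j : SplitIdx L, ‖((unitAt k j : (𝕂 j)ˣ) : 𝕂 j)‖ = 1) :
    distribHaarChar (Space L) k = 1 := by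
  refine distribHaarChar_eq_of_measure_smul_eq_mul (μ := μ L) (s := (box L : Set (Space L)))
    (by rw [μ_box]; exact one_ne_zero) (by rw [μ_box]; exact ENNReal.one_ne_top) ?_
  rw [smul_set_box_of_norm k hk, ENNReal.coe_one, one_mul]

/-- … so the weight of `ω_1(k)` is `1` -/
theorem weight_one_eq_one_of_norm (k : Model L) (hk : ∀ j : SplitIdx L, ‖((unitAt k j : (𝕂 j)ˣ) : 𝕂 j)‖ = 1) :
    weight (Space L) (1 : Model L →* Circle) k = 1 := by
  rw [weight, distribHaarChar_eq_one_of_norm' k hk, NNReal.sqrt_one, NNReal.coe_one, Complex.ofReal_one, mul_one,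
    MonoidHom.one_apply, Circle.coe_one]

/-- `ω_1(k) 1_A = 1_A` for `k` with norm-one split coordinates leaving the finite-measure measurable set `A`
invariant (`ω_1(k) 1_A = 1_{k⁻¹A}`, pv07-g5 `dilationRep_indicatorConstLp`, weight `1`) -/
theorem rep_one_indicatorConstLp_of_invariant (k : Model L)
    (hk : ∀ j : SplitIdx L, ‖((unitAt k j : (𝕂 j)ˣ) : 𝕂 j)‖ = 1) {A : Set (Space L)} (hA : MeasurableSet A)
    (hμA : μ L A ≠ ⊤) (hinv : ∀ x : Space L, k • x ∈ A ↔ x ∈ A) :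
    rep L 1 k (indicatorConstLp 2 hA hμA (1 : ℂ)) = indicatorConstLp 2 hA hμA (1 : ℂ) := by
  rw [dilationRep_indicatorConstLp (μ L) (1 : Model L →* Circle) k hA hμA, weight_one_eq_one_of_norm k hk,
    one_smul]
  refine indicatorConstLp_set_congr (μ L) _ _ hA hμA (Set.ext fun x => ?_) 1
  rw [Set.mem_preimage]
  exact hinv x

/-! ## §3  Every Schwartz–Bruhat vector is `K_T`-spherical -/

/-- the property "fixed by `ω_1(K_T)` for some finite `T`" is a submodule condition: it holds on a submodule
containing every vector with the property (closure under `0`, `+`, scalars; `K_{T ∪ T'} ⊆ K_T ∩ K_{T'}`) -/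
theorem exists_finset_forall_rep_one_eq_self_span {s : Set (Lp ℂ 2 (μ L))}
    (hs : ∀ g ∈ s, ∃ T : Finset (Place (maximalRealSubfield L)),
      ∀ k ∈ RestrictedProduct.boxSubgroup (genLevel L) T, rep L 1 k g = g)
    {f : Lp ℂ 2 (μ L)} (hf : f ∈ Submodule.span ℂ s) :
    ∃ T : Finset (Place (maximalRealSubfield L)), ∀ k ∈ RestrictedProduct.boxSubgroup (genLevel L) T,
      rep L 1 k f = f := by
  classical
  induction hf using Submodule.span_induction with
  | mem g hg => exact hs g hg
  | zero => exact ⟨∅, fun k _ => map_zero _⟩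
  | add f f' _ _ hf hf' =>
    obtain ⟨T, hT⟩ := hf
    obtain ⟨T', hT'⟩ := hf'
    refine ⟨T ∪ T', fun k hk => ?_⟩
    rw [map_add, hT k (boxSubgroup_antitone (genLevel L) Finset.subset_union_left hk),
      hT' k (boxSubgroup_antitone (genLevel L) Finset.subset_union_right hk)]
  | smul c f _ hf =>
    obtain ⟨T, hT⟩ := hf
    exact ⟨T, fun k hk => by rw [map_smul, hT k hk]⟩

/-- **a compact open set is invariant under some `K_T`.**  `A` is a union of level cosets `x₀ + B_n` of ONE level
(row 1a `exists_level_saturate`), finitely many by compactness; take `T` = the union of the sets of §1 for these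
cosets; the converse inclusion is the direct one for `k⁻¹ ∈ K_T`. -/
theorem exists_finset_forall_smul_mem_iff {A : Set (Space L)} (hA : IsCompact A) (hAo : IsOpen A) :
    ∃ T : Finset (Place (maximalRealSubfield L)), ∀ k ∈ RestrictedProduct.boxSubgroup (genLevel L) T,
      ∀ x : Space L, k • x ∈ A ↔ x ∈ A := by
  classical
  obtain ⟨n, hn⟩ := exists_level_saturate hA hAo
  obtain ⟨t, htA, hcov⟩ := hA.elim_nhds_subcover (fun x => ballCoset L x n) (fun x _ => ballCoset_mem_nhds x n)
  choose T hT using fun x : Space L => exists_finset_norm_sub_one_smul_le x n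
  have key : ∀ k ∈ RestrictedProduct.boxSubgroup (genLevel L) (t.biUnion T), ∀ x ∈ A, k • x ∈ A := by
    intro k hk x hx
    obtain ⟨x₀, hx₀t, hx₀⟩ := Set.mem_iUnion₂.1 (hcov hx)
    have hk₀ : k ∈ RestrictedProduct.boxSubgroup (genLevel L) (T x₀) :=
      boxSubgroup_antitone (genLevel L) (Finset.subset_biUnion_of_mem T hx₀t) hk
    have h1 : k • x ∈ ballCoset L x₀ n :=
      smul_mem_ballCoset_of_norm k (norm_unitAt_eq_one_of_mem_boxSubgroup hk) (hT x₀ k hk₀) hx₀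
    rw [mem_ballCoset_iff_sub_mem] at h1
    have h2 := hn x₀ (htA x₀ hx₀t) _ h1
    rwa [add_sub_cancel] at h2
  refine ⟨t.biUnion T, fun k hk x => ⟨fun h => ?_, key k hk x⟩⟩
  have h' := key k⁻¹ (inv_mem hk) (k • x) h
  rwa [inv_smul_smul] at h'

/-- hence the indicator of a compact open set is fixed by some `ω_1(K_T)` -/
theorem exists_finset_forall_rep_one_indCO {A : Set (Space L)} (hA : IsCompact A) (hAo : IsOpen A) :
    ∃ T : Finset (Place (maximalRealSubfield L)), ∀ k ∈ RestrictedProduct.boxSubgroup (genLevel L) T,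
      rep L 1 k (indCO L A hA hAo) = indCO L A hA hAo := by
  obtain ⟨T, hT⟩ := exists_finset_forall_smul_mem_iff hA hAo
  refine ⟨T, fun k hk => ?_⟩
  unfold indCO
  exact rep_one_indicatorConstLp_of_invariant k (norm_unitAt_eq_one_of_mem_boxSubgroup hk) _ _ (hT k hk)

/-- **HEADLINE.** Every Schwartz–Bruhat vector `f ∈ 𝒮(X)` is fixed by the level subgroup `K_T` of the model group,
acting through `ω_1`, for some finite set of places `T`. -/
theorem exists_finset_forall_rep_one_eq_self {f : Lp ℂ 2 (μ L)} (hf : f ∈ schwartzBruhat L) :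
    ∃ T : Finset (Place (maximalRealSubfield L)), ∀ k ∈ RestrictedProduct.boxSubgroup (genLevel L) T,
      rep L 1 k f = f := by
  refine exists_finset_forall_rep_one_eq_self_span (fun g hg => ?_) hf
  obtain ⟨⟨A, hA, hAo⟩, rfl⟩ := hg
  exact exists_finset_forall_rep_one_indCO hA hAo

/-- `ω_ν(k) = ν(k) ω_1(k)` (pv07-g4 `rep_eq_smul_rep_one`, restated without the unused local measurable-structure
binders of that file's main section) -/
theorem rep_eq_smul_rep_one' (ν : Model L →* Circle) (k : Model L) (w : Lp ℂ 2 (μ L)) :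
    rep L ν k w = ((ν k : Circle) : ℂ) • rep L 1 k w := by
  apply Lp.ext
  filter_upwards [coeFn_dilationRep (μ L) ν k w, coeFn_dilationRep (μ L) (1 : Model L →* Circle) k w,
    Lp.coeFn_smul (((ν k : Circle) : ℂ)) (rep L 1 k w)] with x e1 e2 e3
  rw [e1, e3, Pi.smul_apply, e2, smul_eq_mul, weight, weight, MonoidHom.one_apply, Circle.coe_one, one_mul,
    mul_assoc]

/-- **HEADLINE, twisted form.** For every character `ν` of the model group and every `f ∈ 𝒮(X)` there is a finite
`T` with `ω_ν(k) f = ν(k) • f` for all `k ∈ K_T`; combined with pv07-g4 `exists_level_char_trivial` (a continuous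
`ν` is trivial on some `K_{T'}`) this is the `hK` binder of the END theorem for arbitrary Schwartz–Bruhat test
vectors. -/
theorem exists_finset_forall_rep_eq_smul (ν : Model L →* Circle) {f : Lp ℂ 2 (μ L)} (hf : f ∈ schwartzBruhat L) :
    ∃ T : Finset (Place (maximalRealSubfield L)), ∀ k ∈ RestrictedProduct.boxSubgroup (genLevel L) T,
      rep L ν k f = ((ν k : Circle) : ℂ) • f := by
  obtain ⟨T, hT⟩ := exists_finset_forall_rep_one_eq_self hf
  exact ⟨T, fun k hk => by rw [rep_eq_smul_rep_one' ν k f, hT k hk]⟩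

/-- **the `hK` binder for `𝒮(X)`**: if moreover `ν` is trivial on `K_{T'}`, then `ω_ν(K_{T ∪ T'})` fixes `f` -/
theorem exists_finset_forall_rep_eq_self (ν : Model L →* Circle) {T' : Finset (Place (maximalRealSubfield L))}
    (hν : ∀ k ∈ RestrictedProduct.boxSubgroup (genLevel L) T', ν k = 1) {f : Lp ℂ 2 (μ L)}
    (hf : f ∈ schwartzBruhat L) :
    ∃ T : Finset (Place (maximalRealSubfield L)), T' ⊆ T ∧
      ∀ k ∈ RestrictedProduct.boxSubgroup (genLevel L) T, rep L ν k f = f := by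
  classical
  obtain ⟨T, hT⟩ := exists_finset_forall_rep_eq_smul ν hf
  refine ⟨T' ∪ T, Finset.subset_union_left, fun k hk => ?_⟩
  rw [hT k (boxSubgroup_antitone (genLevel L) Finset.subset_union_right hk),
    hν k (boxSubgroup_antitone (genLevel L) Finset.subset_union_left hk), Circle.coe_one, one_smul]

end Coeff

end HodgeCM.PerL34.PureTensor.SchrodingerModel
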